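import Mathlib
import Literature.Analysis.Matrix.DirichletLaplacianSineModes
import HarnessLib

/-!
# Completeness of the 2-D sine modes: `min_{a,b} |λ_a + λ_b − s|` IS a rigorous σ-floor of the shifted Dirichlet Laplacian

Topic `Literature/Analysis/Matrix`; support file (all proved; no definitions; no named facts; plumbing lemmas are `private`).

Companion of `Literature.Analysis.Matrix.DirichletLaplacianSineModes` (which proves that every σ-floor `f` of
`L − s·1`, `L = T ⊕ T` the five-point Dirichlet Laplacian on the `m × m` grid, satisfies `f ≤ |λ_a + λ_b − s|` for all modes).
Here the converse: the `m²` separable sine modes `e_a ⊗ e_b` (`1 ≤ a, b ≤ m`) are pairwise ORTHOGONAL with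
`‖e_a ⊗ e_b‖₂² = ((m+1)/2)²` — the discrete sine orthogonality (DST-I) already in the tree
(`Literature.Probability.LatticeModels.sum_range_sin_mul_sin`) applied in each factor — hence, being `m² = dim` many, an
orthonormal basis after scaling; since `L − s·1` is symmetric and acts on the basis diagonally with eigenvalues
`λ_a + λ_b − s`, Parseval gives `‖(L − s·1)v‖₂² = Σ (λ_a + λ_b − s)² |⟪b_{ab}, v⟫|² ≥ g² ‖v‖₂²` for any `0 ≤ g ≤ min |λ_a + λ_b − s|`.
So `g` is itself a σ-floor in the cell's predicate language (`∀ v, g‖v‖₂ ≤ ‖(L − s·1)v‖₂`), and together with the companion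
file the supremum of the σ-floors of `L − s·1` is EXACTLY `min_{a,b} |λ_a + λ_b − s|` — the value the certnum «lapshift» oracle
(`pub/certnum/certnum-ila-1/fixtures-032/lapshift_oracle.py`) prints as `σ_min`, which makes BOTH fixture checks («floor ≤ σ_min»
and «σ_min ≤ ceiling») sound.

* `sum_sineMode_mul_sineMode` — `Σ_i e_a(i) e_{a'}(i) = (m+1)/2 · [a = a']` for `1 ≤ a, a' ≤ m` (DST-I orthogonality,
  [cite: NoscheseReichel2019, §1 eq. (3)] eigenvectors of the symmetric tridiagonal Toeplitz matrix, orthogonal as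
  eigenvectors of distinct simple eigenvalues; here via the explicit trigonometric sum).
* `shifted_kroneckerSum_sigma_lower` — the main statement: `0 ≤ g ≤ |λ_a + λ_b − s|` for all `a, b` ⇒
  `∀ v, g‖v‖₂ ≤ ‖(T ⊕ T − s·1)v‖₂`.

Real matrices; Euclidean norm via `WithLp.toLp 2`; the tridiagonal `T` by hypothesis on its entries as in the companion file.
Everything here is folklore / PROVED.  Deliberately NOT here: floating-point statements about the benchmark matrices.
-/

open scoped Matrix InnerProductSpace

namespace Literature.Analysis.Matrix.DirichletLaplacianSineCompleteness

open _root_.Matrix WithLp Literature.Probability.LatticeModels Literature.Analysis.Matrix.KroneckerSum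
  Literature.Analysis.Matrix.DirichletLaplacianSineModes

variable {m : ℕ}

/-! ## DST-I orthogonality of the 1-D sine modes -/

/-- **Orthogonality of the sine modes.** For `1 ≤ a, a' ≤ m`,
`Σ_{i < m} sin(a(i+1)π/(m+1)) sin(a'(i+1)π/(m+1)) = (m+1)/2` if `a = a'` and `0` otherwise — the eigenvectors
`x_h = (sin(hkπ/(n+1)))_k` of the symmetric tridiagonal Toeplitz matrix are pairwise orthogonal with squared norm `(n+1)/2`
(DST-I; in the tree as `sum_range_sin_mul_sin`). [cite: NoscheseReichel2019, §1 eq. (3) (eigenvectors of T = (n; −1, 2, −1), distinct eigenvalues (2); orthogonality + norm via the discrete sine sum)] -/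
theorem sum_sineMode_mul_sineMode {a a' : ℕ} (ha : 1 ≤ a) (ham : a ≤ m) (ha' : 1 ≤ a') (ha'm : a' ≤ m) :
    (∑ i : Fin m, dstSin m a ((i : ℕ) + 1) * dstSin m a' ((i : ℕ) + 1)) =
      if a = a' then ((m : ℝ) + 1) / 2 else 0 := by
  have key := sum_range_sin_mul_sin m (X := a) (X' := a') ⟨by exact_mod_cast ha, by exact_mod_cast ham⟩
    ⟨by exact_mod_cast ha', by exact_mod_cast ha'm⟩
  -- our sum over `i : Fin m` of the samples at `i + 1` is the range sum over `j = 0 … m` (the `j = 0` sample vanishes)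
  have hshift : (∑ i : Fin m, dstSin m a ((i : ℕ) + 1) * dstSin m a' ((i : ℕ) + 1)) =
      ∑ j ∈ Finset.range (m + 1), Real.sin (j * (a * (Real.pi / (m + 1)))) * Real.sin (j * (a' * (Real.pi / (m + 1)))) := by
    rw [Finset.sum_range_succ', Nat.cast_zero, zero_mul, zero_mul, Real.sin_zero, zero_mul, add_zero,
      ← Fin.sum_univ_eq_sum_range (fun j : ℕ => Real.sin (((j + 1 : ℕ) : ℝ) * (a * (Real.pi / (m + 1)))) *
        Real.sin (((j + 1 : ℕ) : ℝ) * (a' * (Real.pi / (m + 1))))) m]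
    refine Finset.sum_congr rfl fun i _ => ?_
    unfold dstSin
    push_cast
    ring_nf
  rw [hshift]
  exact_mod_cast key

/-! ## The separable modes as an orthonormal basis of `ℝ^{m × m}` -/

/-- Inner products of the separable modes factor: `⟪e_a ⊗ e_b, e_{a'} ⊗ e_{b'}⟫ = (Σ e_a e_{a'})(Σ e_b e_{b'})` (plumbing).
[folklore] -/
private theorem inner_modes (a b a' b' : ℕ) :
    ⟪toLp 2 (fun p : Fin m × Fin m => dstSin m a ((p.1 : ℕ) + 1) * dstSin m b ((p.2 : ℕ) + 1)),
      toLp 2 (fun p : Fin m × Fin m => dstSin m a' ((p.1 : ℕ) + 1) * dstSin m b' ((p.2 : ℕ) + 1))⟫_ℝ =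
      (∑ i : Fin m, dstSin m a ((i : ℕ) + 1) * dstSin m a' ((i : ℕ) + 1)) *
        ∑ j : Fin m, dstSin m b ((j : ℕ) + 1) * dstSin m b' ((j : ℕ) + 1) := by
  rw [EuclideanSpace.inner_toLp_toLp, star_trivial, dotProduct, Fintype.sum_prod_type, Finset.sum_mul_sum]
  refine Finset.sum_congr rfl fun i _ => Finset.sum_congr rfl fun j _ => ?_
  ring

/-- The scaled separable modes `(2/(m+1)) · (e_{a+1} ⊗ e_{b+1})`, `(a, b) : Fin m × Fin m`, are ORTHONORMAL in `ℝ^{m×m}`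
(plumbing for the Parseval step). [folklore] -/
private theorem orthonormal_scaledModes :
    Orthonormal ℝ (fun κ : Fin m × Fin m => (2 / ((m : ℝ) + 1)) •
      toLp 2 (fun p : Fin m × Fin m => dstSin m ((κ.1 : ℕ) + 1) ((p.1 : ℕ) + 1) * dstSin m ((κ.2 : ℕ) + 1) ((p.2 : ℕ) + 1))) := by
  rw [orthonormal_iff_ite]
  intro κ κ'
  rw [real_inner_smul_left, real_inner_smul_right, inner_modes,
    sum_sineMode_mul_sineMode (m := m) (by omega) (by omega) (by omega) (by omega),
    sum_sineMode_mul_sineMode (m := m) (by omega) (by omega) (by omega) (by omega)]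
  have hm : (0 : ℝ) < (m : ℝ) + 1 := by positivity
  by_cases h : κ = κ'
  · subst h
    rw [if_pos rfl, if_pos rfl, if_pos rfl]
    field_simp
  · rw [if_neg h]
    have : (κ.1 : ℕ) + 1 ≠ (κ'.1 : ℕ) + 1 ∨ (κ.2 : ℕ) + 1 ≠ (κ'.2 : ℕ) + 1 := by
      by_cases h1 : (κ.1 : ℕ) + 1 = (κ'.1 : ℕ) + 1
      · exact Or.inr fun h2 => h (Prod.ext (Fin.ext (by omega)) (Fin.ext (by omega)))
      · exact Or.inl h1
    rcases this with h1 | h2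
    · rw [if_neg h1]; ring
    · rw [if_neg h2]; ring

/-! ## Symmetry of the shifted Kronecker sum -/

/-- The second-difference matrix given by its entries is symmetric (plumbing). [folklore] -/
private theorem secondDifference_transpose (T : Matrix (Fin m) (Fin m) ℝ)
    (hT : ∀ i j : Fin m, T i j = if i = j then 2 else if (i : ℕ) + 1 = (j : ℕ) ∨ (j : ℕ) + 1 = (i : ℕ) then -1 else 0) :
    Tᵀ = T := by
  ext i j
  rw [transpose_apply, hT j i, hT i j]
  by_cases h : i = j
  · subst h; rfl
  · rw [if_neg (Ne.symm h), if_neg h]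
    exact if_congr or_comm rfl rfl

/-- `(A ⊕ B)ᵀ = Aᵀ ⊕ Bᵀ` (plumbing). [folklore] -/
private theorem kroneckerSum_transpose {p q : Type*} [Fintype p] [DecidableEq p] [Fintype q] [DecidableEq q]
    (A : Matrix p p ℝ) (B : Matrix q q ℝ) : (kroneckerSum A B)ᵀ = kroneckerSum Aᵀ Bᵀ := by
  rw [kroneckerSum, kroneckerSum, transpose_add, ← kroneckerMap_transpose, ← kroneckerMap_transpose, transpose_one,
    transpose_one]

/-- For a symmetric real matrix `M`, `⟪x, M y⟫ = ⟪M x, y⟫` in `ℝ^n` (plumbing). [folklore] -/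
private theorem inner_toLp_mulVec_of_transpose_eq {n : Type*} [Fintype n] {M : Matrix n n ℝ} (hM : Mᵀ = M)
    (x y : n → ℝ) : ⟪toLp 2 x, toLp 2 (M *ᵥ y)⟫_ℝ = ⟪toLp 2 (M *ᵥ x), toLp 2 y⟫_ℝ := by
  rw [EuclideanSpace.inner_toLp_toLp, EuclideanSpace.inner_toLp_toLp, star_trivial, star_trivial,
    dotProduct_comm (M *ᵥ y) x, dotProduct_mulVec, ← mulVec_transpose, hM, dotProduct_comm]

/-! ## The oracle value is a σ-floor -/

/-- **`min_{a,b} |λ_a + λ_b − s|` is a rigorous σ-floor of the shifted 2-D Dirichlet Laplacian.**  Let `T` be the `m × m`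
second-difference matrix (entries by hypothesis), `L = T ⊕ T` its Kronecker sum, `s` a real shift, and `0 ≤ g` a number with
`g ≤ |(2 − 2cos((a+1)π/(m+1))) + (2 − 2cos((b+1)π/(m+1))) − s|` for ALL `(a, b) : Fin m × Fin m`.  Then
`g‖v‖₂ ≤ ‖(L − s·1)v‖₂` for every `v` — `g` is a σ-floor in the cell's predicate language.  Proof: the scaled separable sine
modes form an orthonormal basis (DST-I orthogonality, `m²` vectors in dimension `m²`), `L − s·1` is symmetric and multiplies
each basis vector by `λ_{a+1} + λ_{b+1} − s` (`DirichletLaplacianSineModes.secondDifference_mulVec_sineMode`,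
`kroneckerSum_mulVec_tensor_of_mulVec_eq_smul`), and Parseval (`OrthonormalBasis.sum_sq_norm_inner_right`) gives
`‖(L − s·1)v‖₂² = Σ (λ + λ' − s)² ⟪b, v⟫² ≥ g² ‖v‖₂²`.  With the companion bound every σ-floor is `≤` each `|λ_a + λ_b − s|`,
so the best σ-floor of `L − s·1` is exactly their minimum. [cite: NoscheseReichel2019, §1 eq. (2)–(3) (complete eigen-system of the symmetric tridiagonal Toeplitz matrix; tensorised for the Kronecker sum and read through Parseval as a lower bound ‖(L − s·1)v‖₂ ≥ min|λ_a + λ_b − s| ‖v‖₂)] -/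
theorem shifted_kroneckerSum_sigma_lower (T : Matrix (Fin m) (Fin m) ℝ)
    (hT : ∀ i j : Fin m, T i j = if i = j then 2 else if (i : ℕ) + 1 = (j : ℕ) ∨ (j : ℕ) + 1 = (i : ℕ) then -1 else 0)
    (s g : ℝ) (hg0 : 0 ≤ g)
    (hg : ∀ a b : Fin m,
      g ≤ |(2 - 2 * Real.cos (dstAngle m ((a : ℕ) + 1))) + (2 - 2 * Real.cos (dstAngle m ((b : ℕ) + 1))) - s|)
    (v : Fin m × Fin m → ℝ) :
    g * ‖toLp 2 v‖ ≤ ‖toLp 2 ((kroneckerSum T T - s • (1 : Matrix (Fin m × Fin m) (Fin m × Fin m) ℝ)) *ᵥ v)‖ := by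
  rcases Nat.eq_zero_or_pos m with hm0 | hm
  · -- the empty grid: every vector is zero
    subst hm0
    have hv : v = 0 := funext fun p => Fin.elim0 p.1
    simp [hv]
  haveI : Nonempty (Fin m × Fin m) := ⟨(⟨0, hm⟩, ⟨0, hm⟩)⟩
  set M : Matrix (Fin m × Fin m) (Fin m × Fin m) ℝ := kroneckerSum T T - s • (1 : Matrix (Fin m × Fin m) (Fin m × Fin m) ℝ)
    with hMdef
  -- the orthonormal basis of scaled separable sine modes
  set u : Fin m × Fin m → (Fin m × Fin m → ℝ) := fun κ p =>
    dstSin m ((κ.1 : ℕ) + 1) ((p.1 : ℕ) + 1) * dstSin m ((κ.2 : ℕ) + 1) ((p.2 : ℕ) + 1) with hudef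
  set c : ℝ := 2 / ((m : ℝ) + 1) with hcdef
  have hon : Orthonormal ℝ (fun κ : Fin m × Fin m => c • toLp 2 (u κ)) := orthonormal_scaledModes (m := m)
  have hcard : Fintype.card (Fin m × Fin m) = Module.finrank ℝ (EuclideanSpace ℝ (Fin m × Fin m)) := by
    rw [finrank_euclideanSpace]
  have hsp : ⊤ ≤ Submodule.span ℝ (Set.range fun κ : Fin m × Fin m => c • toLp 2 (u κ)) := by
    rw [← coe_basisOfOrthonormalOfCardEqFinrank hon hcard, Module.Basis.span_eq]
  let B : OrthonormalBasis (Fin m × Fin m) ℝ (EuclideanSpace ℝ (Fin m × Fin m)) := OrthonormalBasis.mk hon hsp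
  have hB : ∀ κ, B κ = c • toLp 2 (u κ) := fun κ => by
    simp only [B, OrthonormalBasis.coe_mk]
  -- the eigen-relation of `M` on each mode
  have hTt : Tᵀ = T := secondDifference_transpose T hT
  have hMt : Mᵀ = M := by
    rw [hMdef, transpose_sub, kroneckerSum_transpose, hTt, transpose_smul, transpose_one]
  have heig : ∀ κ : Fin m × Fin m, M *ᵥ u κ =
      ((2 - 2 * Real.cos (dstAngle m ((κ.1 : ℕ) + 1))) + (2 - 2 * Real.cos (dstAngle m ((κ.2 : ℕ) + 1))) - s) • u κ := by
    intro κ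
    have hL := kroneckerSum_mulVec_tensor_of_mulVec_eq_smul (secondDifference_mulVec_sineMode T hT ((κ.1 : ℕ) + 1))
      (secondDifference_mulVec_sineMode T hT ((κ.2 : ℕ) + 1))
    rw [hMdef, sub_mulVec, smul_mulVec, one_mulVec, hudef]
    simp only
    rw [hL, sub_smul]
  -- Parseval on both sides
  set x : EuclideanSpace ℝ (Fin m × Fin m) := toLp 2 v with hxdef
  set y : EuclideanSpace ℝ (Fin m × Fin m) := toLp 2 (M *ᵥ v) with hydef
  have hcoef : ∀ κ, ⟪B κ, y⟫_ℝ =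
      ((2 - 2 * Real.cos (dstAngle m ((κ.1 : ℕ) + 1))) + (2 - 2 * Real.cos (dstAngle m ((κ.2 : ℕ) + 1))) - s) * ⟪B κ, x⟫_ℝ := by
    intro κ
    rw [hB, hydef, hxdef, real_inner_smul_left, real_inner_smul_left, inner_toLp_mulVec_of_transpose_eq hMt, heig κ,
      toLp_smul, real_inner_smul_left]
    ring
  have hy : ‖y‖ ^ 2 = ∑ κ, ⟪B κ, y⟫_ℝ ^ 2 := by
    rw [← B.sum_sq_norm_inner_right y]
    simp only [Real.norm_eq_abs, sq_abs]
  have hx : ‖x‖ ^ 2 = ∑ κ, ⟪B κ, x⟫_ℝ ^ 2 := by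
    rw [← B.sum_sq_norm_inner_right x]
    simp only [Real.norm_eq_abs, sq_abs]
  have hsq : (g * ‖x‖) ^ 2 ≤ ‖y‖ ^ 2 := by
    rw [mul_pow, hx, hy, Finset.mul_sum]
    refine Finset.sum_le_sum fun κ _ => ?_
    rw [hcoef κ, mul_pow]
    have h1 : g ^ 2 ≤ ((2 - 2 * Real.cos (dstAngle m ((κ.1 : ℕ) + 1))) +
        (2 - 2 * Real.cos (dstAngle m ((κ.2 : ℕ) + 1))) - s) ^ 2 := by
      rw [← sq_abs ((2 - 2 * Real.cos (dstAngle m ((κ.1 : ℕ) + 1))) + _ - s)]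
      exact pow_le_pow_left₀ hg0 (hg κ.1 κ.2) 2
    exact mul_le_mul_of_nonneg_right h1 (sq_nonneg _)
  have hy0 : 0 ≤ ‖y‖ := norm_nonneg _
  have hgx : 0 ≤ g * ‖x‖ := mul_nonneg hg0 (norm_nonneg _)
  exact (pow_le_pow_iff_left₀ hgx hy0 two_ne_zero).1 hsq

/-! ## The operator norm: `max_{a,b} |λ_a + λ_b − s|` is a ceiling and no ceiling is smaller (appended 2026-08-28, certnum-ila-1 g9) -/

/-- The first entry of a sine mode, `sin(kπ/(m+1))`, is positive for `1 ≤ k ≤ m` (plumbing; private twin of the companion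
file's lemma). [folklore] -/
private theorem dstSin_one_pos' {k : ℕ} (hk : 1 ≤ k) (hkm : k ≤ m) : 0 < dstSin m k 1 := by
  unfold dstSin
  push_cast
  rw [one_mul]
  apply Real.sin_pos_of_pos_of_lt_pi
  · positivity
  · rw [mul_div_assoc', div_lt_iff₀ (by positivity : (0 : ℝ) < (m : ℝ) + 1)]
    have : (k : ℝ) ≤ m := by exact_mod_cast hkm
    nlinarith [Real.pi_pos]


/-- **`max_{a,b} |λ_a + λ_b − s|` is a rigorous operator-norm CEILING of the shifted 2-D Dirichlet Laplacian.**  With `T`,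
`L = T ⊕ T`, `s` as above and `G` any number with `|(2 − 2cos((a+1)π/(m+1))) + (2 − 2cos((b+1)π/(m+1))) − s| ≤ G` for ALL
`(a, b) : Fin m × Fin m`, every `v` satisfies `‖(L − s·1)v‖₂ ≤ G‖v‖₂` — the same orthonormal-basis / Parseval computation as
`shifted_kroneckerSum_sigma_lower`, read upward.  (The certnum «lapshift» oracle prints `‖A‖₂ = max |λ_a + λ_b − s|`; this is
the «it is a ceiling» half.) [cite: NoscheseReichel2019, §1 eq. (2)–(3) (complete eigen-system of the symmetric tridiagonal Toeplitz matrix; tensorised and read through Parseval as ‖(L − s·1)v‖₂ ≤ max|λ_a + λ_b − s| ‖v‖₂)] -/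
theorem shifted_kroneckerSum_opNorm_le (T : Matrix (Fin m) (Fin m) ℝ)
    (hT : ∀ i j : Fin m, T i j = if i = j then 2 else if (i : ℕ) + 1 = (j : ℕ) ∨ (j : ℕ) + 1 = (i : ℕ) then -1 else 0)
    (s G : ℝ)
    (hG : ∀ a b : Fin m,
      |(2 - 2 * Real.cos (dstAngle m ((a : ℕ) + 1))) + (2 - 2 * Real.cos (dstAngle m ((b : ℕ) + 1))) - s| ≤ G)
    (v : Fin m × Fin m → ℝ) :
    ‖toLp 2 ((kroneckerSum T T - s • (1 : Matrix (Fin m × Fin m) (Fin m × Fin m) ℝ)) *ᵥ v)‖ ≤ G * ‖toLp 2 v‖ := by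
  rcases Nat.eq_zero_or_pos m with hm0 | hm
  · subst hm0
    have hv : v = 0 := funext fun p => Fin.elim0 p.1
    simp [hv]
  haveI : Nonempty (Fin m × Fin m) := ⟨(⟨0, hm⟩, ⟨0, hm⟩)⟩
  have hG0 : 0 ≤ G := le_trans (abs_nonneg _) (hG ⟨0, hm⟩ ⟨0, hm⟩)
  set M : Matrix (Fin m × Fin m) (Fin m × Fin m) ℝ := kroneckerSum T T - s • (1 : Matrix (Fin m × Fin m) (Fin m × Fin m) ℝ)
    with hMdef
  set u : Fin m × Fin m → (Fin m × Fin m → ℝ) := fun κ p =>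
    dstSin m ((κ.1 : ℕ) + 1) ((p.1 : ℕ) + 1) * dstSin m ((κ.2 : ℕ) + 1) ((p.2 : ℕ) + 1) with hudef
  set c : ℝ := 2 / ((m : ℝ) + 1) with hcdef
  have hon : Orthonormal ℝ (fun κ : Fin m × Fin m => c • toLp 2 (u κ)) := orthonormal_scaledModes (m := m)
  have hcard : Fintype.card (Fin m × Fin m) = Module.finrank ℝ (EuclideanSpace ℝ (Fin m × Fin m)) := by
    rw [finrank_euclideanSpace]
  have hsp : ⊤ ≤ Submodule.span ℝ (Set.range fun κ : Fin m × Fin m => c • toLp 2 (u κ)) := by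
    rw [← coe_basisOfOrthonormalOfCardEqFinrank hon hcard, Module.Basis.span_eq]
  let B : OrthonormalBasis (Fin m × Fin m) ℝ (EuclideanSpace ℝ (Fin m × Fin m)) := OrthonormalBasis.mk hon hsp
  have hB : ∀ κ, B κ = c • toLp 2 (u κ) := fun κ => by
    simp only [B, OrthonormalBasis.coe_mk]
  have hTt : Tᵀ = T := secondDifference_transpose T hT
  have hMt : Mᵀ = M := by
    rw [hMdef, transpose_sub, kroneckerSum_transpose, hTt, transpose_smul, transpose_one]
  have heig : ∀ κ : Fin m × Fin m, M *ᵥ u κ =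
      ((2 - 2 * Real.cos (dstAngle m ((κ.1 : ℕ) + 1))) + (2 - 2 * Real.cos (dstAngle m ((κ.2 : ℕ) + 1))) - s) • u κ := by
    intro κ
    have hL := kroneckerSum_mulVec_tensor_of_mulVec_eq_smul (secondDifference_mulVec_sineMode T hT ((κ.1 : ℕ) + 1))
      (secondDifference_mulVec_sineMode T hT ((κ.2 : ℕ) + 1))
    rw [hMdef, sub_mulVec, smul_mulVec, one_mulVec, hudef]
    simp only
    rw [hL, sub_smul]
  set x : EuclideanSpace ℝ (Fin m × Fin m) := toLp 2 v with hxdef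
  set y : EuclideanSpace ℝ (Fin m × Fin m) := toLp 2 (M *ᵥ v) with hydef
  have hcoef : ∀ κ, ⟪B κ, y⟫_ℝ =
      ((2 - 2 * Real.cos (dstAngle m ((κ.1 : ℕ) + 1))) + (2 - 2 * Real.cos (dstAngle m ((κ.2 : ℕ) + 1))) - s) * ⟪B κ, x⟫_ℝ := by
    intro κ
    rw [hB, hydef, hxdef, real_inner_smul_left, real_inner_smul_left, inner_toLp_mulVec_of_transpose_eq hMt, heig κ,
      toLp_smul, real_inner_smul_left]
    ring
  have hy : ‖y‖ ^ 2 = ∑ κ, ⟪B κ, y⟫_ℝ ^ 2 := by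
    rw [← B.sum_sq_norm_inner_right y]
    simp only [Real.norm_eq_abs, sq_abs]
  have hx : ‖x‖ ^ 2 = ∑ κ, ⟪B κ, x⟫_ℝ ^ 2 := by
    rw [← B.sum_sq_norm_inner_right x]
    simp only [Real.norm_eq_abs, sq_abs]
  have hsq : ‖y‖ ^ 2 ≤ (G * ‖x‖) ^ 2 := by
    rw [mul_pow, hx, hy, Finset.mul_sum]
    refine Finset.sum_le_sum fun κ _ => ?_
    rw [hcoef κ, mul_pow]
    have h1 : ((2 - 2 * Real.cos (dstAngle m ((κ.1 : ℕ) + 1))) +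
        (2 - 2 * Real.cos (dstAngle m ((κ.2 : ℕ) + 1))) - s) ^ 2 ≤ G ^ 2 := by
      rw [← sq_abs ((2 - 2 * Real.cos (dstAngle m ((κ.1 : ℕ) + 1))) + _ - s)]
      exact pow_le_pow_left₀ (abs_nonneg _) (hG κ.1 κ.2) 2
    exact mul_le_mul_of_nonneg_right h1 (sq_nonneg _)
  have hy0 : 0 ≤ ‖y‖ := norm_nonneg _
  have hgx : 0 ≤ G * ‖x‖ := mul_nonneg hG0 (norm_nonneg _)
  exact (pow_le_pow_iff_left₀ hy0 hgx two_ne_zero).1 hsq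

/-- **No ceiling is below any `|λ_a + λ_b − s|`.**  If `M'` is an operator-norm ceiling of `L − s·1` in the cell's predicate
language (`∀ v, ‖(L − s·1)v‖₂ ≤ M'‖v‖₂`), then `|λ_a + λ_b − s| ≤ M'` for all `1 ≤ a, b ≤ m` (the separable mode is a witness
whose quotient is exactly that value; `SigmaMinWitness.div_le_of_opNorm_bound`).  With `shifted_kroneckerSum_opNorm_le` the best
ceiling of `L − s·1` is EXACTLY `max_{a,b} |λ_a + λ_b − s|` — the `‖A‖₂` the certnum «lapshift» oracle prints (and, with the
σ-floor statements, its `κ₂`). [cite: NoscheseReichel2019, §1 eq. (2)–(3) (the tridiagonal-Toeplitz eigenpairs, δ = 2, σ = τ = −1, summed pairwise; the mode as a witness for Bernstein2009 Fact 9.13.1, σ_max as the maximum of ‖Ax‖₂/‖x‖₂)] -/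
theorem abs_le_opNorm_bound_shifted_kroneckerSum (T : Matrix (Fin m) (Fin m) ℝ)
    (hT : ∀ i j : Fin m, T i j = if i = j then 2 else if (i : ℕ) + 1 = (j : ℕ) ∨ (j : ℕ) + 1 = (i : ℕ) then -1 else 0)
    (s M' : ℝ)
    (hM' : ∀ v : Fin m × Fin m → ℝ,
      ‖toLp 2 ((kroneckerSum T T - s • (1 : Matrix (Fin m × Fin m) (Fin m × Fin m) ℝ)) *ᵥ v)‖ ≤ M' * ‖toLp 2 v‖)
    {a b : ℕ} (ha : 1 ≤ a) (ham : a ≤ m) (hb : 1 ≤ b) (hbm : b ≤ m) :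
    |(2 - 2 * Real.cos (dstAngle m a)) + (2 - 2 * Real.cos (dstAngle m b)) - s| ≤ M' := by
  have hm : 0 < m := by omega
  set w : Fin m × Fin m → ℝ := fun p => dstSin m a (((p.1 : Fin m) : ℕ) + 1) * dstSin m b (((p.2 : Fin m) : ℕ) + 1) with hw
  have hL := kroneckerSum_mulVec_tensor_of_mulVec_eq_smul (secondDifference_mulVec_sineMode T hT a)
    (secondDifference_mulVec_sineMode T hT b)
  have hLs : (kroneckerSum T T - s • (1 : Matrix (Fin m × Fin m) (Fin m × Fin m) ℝ)) *ᵥ w =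
      ((2 - 2 * Real.cos (dstAngle m a)) + (2 - 2 * Real.cos (dstAngle m b)) - s) • w := by
    rw [sub_mulVec, smul_mulVec, one_mulVec, hw, hL, sub_smul]
  -- `w ≠ 0`: its `(0,0)` entry is `sin(aπ/(m+1)) sin(bπ/(m+1)) ≠ 0`
  have hne : w ≠ 0 := by
    intro h0
    have h00 := congr_fun h0 (⟨0, hm⟩, ⟨0, hm⟩)
    simp only [hw, Pi.zero_apply, Nat.cast_zero, zero_add, mul_eq_zero] at h00
    rcases h00 with h1 | h2
    · exact (dstSin_one_pos' (m := m) ha ham).ne' (by exact_mod_cast h1)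
    · exact (dstSin_one_pos' (m := m) hb hbm).ne' (by exact_mod_cast h2)
  have hpos : 0 < ‖toLp 2 w‖ := by rw [norm_pos_iff, ne_eq, toLp_eq_zero]; exact hne
  have hq := SigmaMinWitness.div_le_of_opNorm_bound hM' hne
  rw [hLs, toLp_smul, norm_smul, Real.norm_eq_abs, mul_div_assoc, div_self hpos.ne', mul_one] at hq
  exact hq

end Literature.Analysis.Matrix.DirichletLaplacianSineCompleteness
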